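import Literature.MathematicalPhysics.QuantumManyBody.PeriodicBoseGasThm31
import Literature.MathematicalPhysics.QuantumManyBody.PeriodicBoseGasFourier
import HarnessLib

/-!
# The fractional periodic energy `∑ᵢ (-Δᵢ)^{α/2} + ∑_{i<j} v^per` through plane-wave occupations

Topic `Literature/MathematicalPhysics/QuantumManyBody` (definition item `defn-fracPeriodicEnergy`),
companion of `PeriodicBoseGas.lean` (same namespace), wanted by route BECDispersionDial of
`AtomisticToContinuum/BoseEinsteinCondensation`, whose items inline both notions below via `let`.

* `planeWaveMode L p` — the normalised plane waves `φ_p(x) = L^{-3/2} e^{2πi p·x/L}`, `p ∈ ℤ³`, of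
  the torus of side `L` (Fournais's Fourier basis `e^{ikx}`, `k ∈ 2πL⁻¹ℤ³`, of `L²(Ω)`,
  `Ω = ℝ³/Lℤ³`, normalised; `φ_0 1_Ω = constantMode L`, the range of his `P_Ω` (1.3));
  `planeWaveMode L p = cellWave L p / √(L³)` (`planeWaveMode_eq`) links it to the Fourier toolkit of
  `PeriodicBoseGasFourier.lean`.
* `fracDispersion α L p = |2πp/L|^α` — the free dispersion, i.e. the Fourier multiplier of the
  fractional Laplacian `(-Δ_per)^{α/2}` on the torus [folklore].
* `fracPeriodicEnergy α v N L ψ = ∑_{p ∈ ℤ³} |2πp/L|^α ⟨φ_p, γ_ψ φ_p⟩ + ∫_{Ω^N} ∑_{i<j} v^per(xᵢ-xⱼ)|ψ|²`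
  — the quadratic form of `∑ᵢ (-Δᵢ^per)^{α/2} + ∑_{i<j} v^per` written through the one-particle
  density matrix `γ_ψ` (`tr γ_ψ |k|^α`, [LSSY2005, §1.2 (1.17)]: `⟨φ, γ_ψ φ⟩ = N ∫|∫ conj(φ)ψ|²`,
  here `cellOccupation` of `PeriodicBoseGas.lean`; by Bose symmetry the factor `N` accounts for the
  sum over the particles), and `fracPeriodicGroundStateEnergy α v N L = inf_Ψ` over periodic trial
  states [Fournais2020, (1.1)–(1.2) for `α = 2`].

`fracPeriodicEnergy α v N L` is *definitionally* the functional `E` inlined in the route items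
(`fracPeriodicEnergy_eq_inline`, proved by `rfl`), so those items can be restated over it verbatim.

## Main results (the requested API)

* `cellOccupation_planeWaveMode_zero` — `⟨φ_0, γ_Ψ φ_0⟩ = condensateOccupation N L Ψ` (Fournais's
  `⟨Ψ, n₀Ψ⟩`, (1.3)–(1.5)).
* `tsum_cellOccupation_planeWaveMode_eq`, `PeriodicTrialState.tsum_cellOccupation_planeWaveMode` —
  **Parseval in the traced variable**: `∑_p ⟨φ_p, γ_Ψ φ_p⟩ = N ∫_{Ω^N}|Ψ|²` (`= N` for a trial state),
  i.e. `tr γ_Ψ = N` [LSSY2005, (1.18)].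
* `tsum_fracDispersion_two_mul_cellOccupation` — **Parseval for the gradient in the traced variable**:
  `∑_p |2πp/L|² ⟨φ_p, γ_Ψ φ_p⟩ = ∫_{Ω^N} |∇Ψ|²` for periodic trial states (derivative rule on the
  3-torus, Tonelli, Bose symmetry), whence `fracPeriodicEnergy_two`:
  `fracPeriodicEnergy 2 v N L Ψ.ψ = periodicEnergy v Ψ` (the route's support item FracEnergyAtTwo)
  and `fracPeriodicGroundStateEnergy_two`.
* `fracDispersion_le_one_add` (`|k|^α ≤ 1 + |k|²` for `0 < α ≤ 2`), whence
  `fracPeriodicEnergy_le_add_two`: `𝓔_α(Ψ) ≤ N + 𝓔_2(Ψ)` and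
  `fracPeriodicGroundStateEnergy_le_add`: `E_α(N,L) ≤ N + E^per(N,L)`.
* `tendsto_fracPeriodicEnergy` — `𝓔_α(Ψ) → ⟨Ψ, HΨ⟩` as `α ↑ 2` for trial states of finite energy
  (dominated convergence on `ℓ¹(ℤ³)` with the bound above), and
  `limsup_fracPeriodicGroundStateEnergy_le`: `limsup_{α↑2} E_α(N,L) ≤ E^per(N,L)` — the first step of
  the mechanism of the route's crux EndpointTransfer.

The Fubini bookkeeping (`lintegral_cellN_succ`: `∫_{Ω^{n+1}} F = ∫_{Ω^n}∫_Ω F(x,Y) dx dY`;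
`cellOccupation_succ`; `gradSqAt_eq_zero_comp_swap`: Bose symmetry moves `∇ᵢ` to the first slot) is
proved here from Mathlib (`measurePreserving_piFinSuccAbove`, `fderiv_comp`) and the slice lemmas
of `PeriodicBoseGasThm31.lean`.

## Design choices

* `ℝ≥0∞` throughout, as `PeriodicBoseGas.lean`; `fracDispersion` uses `Real.rpow` clipped by
  `ENNReal.ofReal` (for `L ≤ 0` the class `PeriodicTrialState N L`, `N ≥ 1`, is empty anyway).
* The occupations are those of the modes *of the cell* (`cellOccupation`: all integrals over
  `[0,L)³` and `[0,L)^{3N}`), so `fracPeriodicEnergy` only sees `ψ` on the fundamental cell, like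
  `periodicEnergy`.
* No operators: `(-Δ)^{α/2}` enters only through its quadratic form in the plane-wave basis, which
  for `α = 2` is *proved* to be the gradient form (`fracPeriodicEnergy_two`), the consistency check
  requested by the route.
* Mathlib has the Fourier basis of `(ℝ/ℤ)^d` (`UnitAddTorus.mFourier*`, transported to the cell in
  `PeriodicBoseGasFourier.lean`) but no fractional Laplacian and no density matrices (searched
  `fracLaplacian`, `FourierMultiplier`, `densityMatrix`, `planeWave`). The tree's
  `Literature.Analysis.FluidPDE.Torus.fracSymbol α k = (4π²|k|²)^α` (unit torus, smooth vector
  fields, convention `(-Δ)^α`) is the same multiplier: `fracDispersion α L p = |2πp/L|^α` is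
  `fracSymbol (α/2) p` rescaled to side `L` and clipped into `ℝ≥0∞`; that file is not imported
  (vector fields on `UnitAddTorus`, Bochner sums — different objects), only the convention is
  recorded here.

## References

* [LSSY2005] E. H. Lieb, R. Seiringer, J. P. Solovej, J. Yngvason, *The Mathematics of the Bose Gas
  and its Condensation*, Birkhäuser 2005 (arXiv:cond-mat/0610117): §1.2 (1.17)–(1.18) (one-particle
  density matrix, `tr γ = N`).
* [Fournais2020] S. Fournais, *Length scales for BEC in the dilute Bose gas*, arXiv:2011.00309, EMS
  Ser. Congr. Rep. 18 (2021): (1.1)–(1.5) (periodic box, `P_Ω`, `n₀`), (3.19) (plane waves).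
-/

noncomputable section

open MeasureTheory Filter WithLp Complex
open scoped ENNReal NNReal ComplexConjugate Topology

namespace Literature.MathematicalPhysics.QuantumManyBody.BoseGas

/-! ### Definitions -/

/-- The **normalised plane wave** `φ_p(x) = L^{-3/2} e^{2πi p·x/L}` of the torus of side `L`,
`p ∈ ℤ³` (momentum `k = 2πp/L ∈ 2πL⁻¹ℤ³`), as a function on `ℝ³`; restricted to the cell `[0,L)³`
these are the normalised Fourier basis of `L²([0,L)³)`, and `φ_0 1_{[0,L)³} = constantMode L`
(`indicator_planeWaveMode_zero`). Written verbatim as inlined in route BECDispersionDial;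
`planeWaveMode L p = cellWave L p / √(L³)` (`planeWaveMode_eq`). [cite: Fournais2020, (1.3) and (3.19)] -/
def planeWaveMode (L : ℝ) (p : Fin 3 → ℤ) : Space → ℂ :=
  fun x : EuclideanSpace ℝ (Fin 3) => ((Real.sqrt (L ^ 3))⁻¹ : ℂ) *
    Complex.exp (2 * Real.pi * Complex.I * ((∑ k : Fin 3, ((p k : ℤ) : ℝ) * x k : ℝ) : ℂ) / (L : ℂ))

/-- The **free dispersion** `|k|^α = |2πp/L|^α ∈ [0,∞]` of the plane wave of index `p ∈ ℤ³` on the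
torus of side `L` (`|p|` Euclidean): the Fourier multiplier (symbol) of `(-Δ_per)^{α/2}`; for
`α = 2` it is `4π²|p|²/L²` (`fracDispersion_two`). [folklore] -/
def fracDispersion (α L : ℝ) (p : Fin 3 → ℤ) : ℝ≥0∞ :=
  ENNReal.ofReal ((2 * Real.pi / L * Real.sqrt (∑ k : Fin 3, ((p k : ℤ) : ℝ) ^ 2)) ^ α)

/-- The **fractional periodic energy** of an `N`-body wave function `ψ` on the torus `(ℝ³/Lℤ³)^N`:
`𝓔_α(ψ) = ∑_{p ∈ ℤ³} |2πp/L|^α ⟨φ_p, γ_ψ φ_p⟩ + ∫_{[0,L)^{3N}} ∑_{i<j} v^per(xᵢ - xⱼ) |ψ|²`, the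
quadratic form of `∑ᵢ (-Δᵢ^per)^{α/2} + ∑_{i<j} v^per(xᵢ - xⱼ)` written through the occupations
`⟨φ_p, γ_ψ φ_p⟩ = cellOccupation N L φ_p ψ` of the plane waves (`tr γ_ψ|k|^α`: the factor `N` inside
`occupation` accounts for the sum over the particles of a Bose-symmetric `ψ`), plus the periodic
interaction as in `periodicEnergy`. For `α = 2` and a periodic trial state this *is*
`periodicEnergy` (`fracPeriodicEnergy_two`). Units `ħ = 2m = 1`.
[cite: LSSY2005, §1.2 (1.17)–(1.18)] -/
def fracPeriodicEnergy (α : ℝ) (v : ℝ → ℝ≥0∞) (N : ℕ) (L : ℝ) (ψ : Config N → ℂ) : ℝ≥0∞ :=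
  (∑' p : Fin 3 → ℤ, fracDispersion α L p * cellOccupation N L (planeWaveMode L p) ψ) +
    ∫⁻ X in cellN N L, periodicInteraction v L X * (‖ψ X‖₊ : ℝ≥0∞) ^ 2

/-- The **fractional periodic ground-state energy** `E_α(N, L) = inf_Ψ 𝓔_α(Ψ)`, infimum over the
periodic `C¹` Bose-symmetric normalised trial states of `PeriodicBoseGas.lean` (`⊤` over an empty
class, e.g. `L ≤ 0 < N`); `E_2 = periodicGroundStateEnergy` (`fracPeriodicGroundStateEnergy_two`).
[cite: Fournais2020, (1.2)] -/
def fracPeriodicGroundStateEnergy (α : ℝ) (v : ℝ → ℝ≥0∞) (N : ℕ) (L : ℝ) : ℝ≥0∞ :=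
  ⨅ Ψ : PeriodicTrialState N L, fracPeriodicEnergy α v N L Ψ.ψ

/-! ### Unfolding: the inlined form of route BECDispersionDial -/

/-- `fracPeriodicEnergy α v N L` *is* the energy functional `E` inlined (`let E := fun ψ => …`) in
the items of route BECDispersionDial, definitionally (`rfl`): restate those items over
`fracPeriodicEnergy` by `rw [fracPeriodicEnergy_eq_inline]` / `show`. [folklore] -/
theorem fracPeriodicEnergy_eq_inline (α : ℝ) (v : ℝ → ℝ≥0∞) (N : ℕ) (L : ℝ) :
    fracPeriodicEnergy α v N L = fun ψ => (∑' p : Fin 3 → ℤ,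
      ENNReal.ofReal ((2 * Real.pi / L * Real.sqrt (∑ k : Fin 3, ((p k : ℤ) : ℝ) ^ 2)) ^ α) *
        cellOccupation N L (fun x : EuclideanSpace ℝ (Fin 3) => ((Real.sqrt (L ^ 3))⁻¹ : ℂ) *
          Complex.exp (2 * Real.pi * Complex.I * ((∑ k : Fin 3, ((p k : ℤ) : ℝ) * x k : ℝ) : ℂ) /
            (L : ℂ))) ψ) +
      ∫⁻ X in cellN N L, periodicInteraction v L X * (‖ψ X‖₊ : ENNReal) ^ 2 :=
  rfl

/-- Pointwise unfolding of `fracPeriodicEnergy`. [folklore] -/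
theorem fracPeriodicEnergy_apply (α : ℝ) (v : ℝ → ℝ≥0∞) (N : ℕ) (L : ℝ) (ψ : Config N → ℂ) :
    fracPeriodicEnergy α v N L ψ =
      (∑' p : Fin 3 → ℤ, fracDispersion α L p * cellOccupation N L (planeWaveMode L p) ψ) +
        ∫⁻ X in cellN N L, periodicInteraction v L X * (‖ψ X‖₊ : ℝ≥0∞) ^ 2 :=
  rfl

/-- Variational principle for the fractional periodic problem. [cite: Fournais2020, (1.2)] -/
theorem fracPeriodicGroundStateEnergy_le (α : ℝ) (v : ℝ → ℝ≥0∞) {N : ℕ} {L : ℝ}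
    (Ψ : PeriodicTrialState N L) :
    fracPeriodicGroundStateEnergy α v N L ≤ fracPeriodicEnergy α v N L Ψ.ψ :=
  iInf_le _ Ψ

/-! ### Plane waves: basic properties -/

/-- `φ_p = L^{-3/2} e_p` with `e_p = cellWave L p` the plane wave of `PeriodicBoseGasFourier`.
[folklore] -/
theorem planeWaveMode_eq (L : ℝ) (p : Fin 3 → ℤ) (x : Space) :
    planeWaveMode L p x = ((Real.sqrt (L ^ 3))⁻¹ : ℂ) * cellWave L p x := by
  rw [cellWave_apply]
  rfl

/-- `φ_0 ≡ L^{-3/2}`. [folklore] -/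
theorem planeWaveMode_zero (L : ℝ) (x : Space) :
    planeWaveMode L 0 x = ((Real.sqrt (L ^ 3))⁻¹ : ℂ) := by
  rw [planeWaveMode_eq, cellWave_zero, mul_one]

/-- The constant mode is the zero-momentum plane wave restricted to the cell. [cite: Fournais2020, (1.3)] -/
theorem indicator_planeWaveMode_zero (L : ℝ) :
    (cell L).indicator (planeWaveMode L 0) = constantMode L := by
  funext x
  by_cases hx : x ∈ cell L
  · simp [constantMode, hx, planeWaveMode_zero]
  · simp [constantMode, hx]

/-- `|φ_p(x)| = L^{-3/2}`. [folklore] -/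
theorem norm_planeWaveMode (L : ℝ) (p : Fin 3 → ℤ) (x : Space) :
    ‖planeWaveMode L p x‖ = (Real.sqrt (L ^ 3))⁻¹ := by
  rw [planeWaveMode_eq, norm_mul, norm_cellWave, mul_one, norm_inv, Complex.norm_real,
    Real.norm_of_nonneg (Real.sqrt_nonneg _)]

/-- The plane waves are smooth. [folklore] -/
theorem contDiff_planeWaveMode (L : ℝ) (p : Fin 3 → ℤ) :
    ContDiff ℝ (⊤ : ℕ∞) (planeWaveMode L p) := by
  have h : planeWaveMode L p = fun x => ((Real.sqrt (L ^ 3))⁻¹ : ℂ) * cellWave L p x :=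
    funext (planeWaveMode_eq L p)
  rw [h]
  exact contDiff_const.mul (contDiff_cellWave L p)

/-- The plane waves are continuous. [folklore] -/
theorem continuous_planeWaveMode (L : ℝ) (p : Fin 3 → ℤ) : Continuous (planeWaveMode L p) :=
  (contDiff_planeWaveMode L p).continuous

/-- The plane waves are `Lℤ³`-periodic. [folklore] -/
theorem planeWaveMode_periodic {L : ℝ} (hL : L ≠ 0) (p : Fin 3 → ℤ) (x : Space) (k : Fin 3) :
    planeWaveMode L p (x + EuclideanSpace.single k L) = planeWaveMode L p x := by
  rw [planeWaveMode_eq, planeWaveMode_eq, cellWave_periodic hL]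

/-- `|∫_Ω conj(φ_p) f|² = L³ |ĉ_p(f)|²`: the inner products with the normalised plane waves on the
cell are the Fourier coefficients `cellFourierCoeff` (normalised as `L⁻³∫ conj(e_p) f`) up to the
factor `L^{3/2}`. [folklore] -/
theorem nnnorm_sq_integral_conj_planeWaveMode_mul {L : ℝ} (hL : 0 < L) (p : Fin 3 → ℤ)
    (f : Space → ℂ) :
    (‖∫ x in cell L, conj (planeWaveMode L p x) * f x‖₊ : ℝ≥0∞) ^ 2 =
      ENNReal.ofReal L ^ 3 * (‖cellFourierCoeff L f p‖₊ : ℝ≥0∞) ^ 2 := by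
  have hL3 : (0 : ℝ) < L ^ 3 := by positivity
  have hint : ∫ x in cell L, conj (planeWaveMode L p x) * f x =
      conj ((Real.sqrt (L ^ 3))⁻¹ : ℂ) * ∫ x in cell L, conj (cellWave L p x) * f x := by
    rw [← integral_const_mul]
    congr 1
    funext x
    rw [planeWaveMode_eq, map_mul, mul_assoc]
  have hcoef : ∫ x in cell L, conj (cellWave L p x) * f x = (L : ℂ) ^ 3 * cellFourierCoeff L f p := by
    rw [cellFourierCoeff_eq_integral hL, Complex.real_smul, ← mul_assoc]
    push_cast
    rw [mul_inv_cancel₀ (pow_ne_zero 3 (Complex.ofReal_ne_zero.2 hL.ne')), one_mul]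
  rw [hint, hcoef, coe_nnnorm_sq_eq_ofReal, coe_nnnorm_sq_eq_ofReal, ← ENNReal.ofReal_pow hL.le,
    ← ENNReal.ofReal_mul hL3.le, norm_mul, norm_mul, Complex.norm_conj, norm_inv, norm_pow,
    Complex.norm_real, Complex.norm_real, Real.norm_of_nonneg (Real.sqrt_nonneg _),
    Real.norm_of_nonneg hL.le]
  congr 1
  rw [mul_pow, mul_pow, inv_pow, Real.sq_sqrt hL3.le]
  field_simp

/-! ### The dispersion -/

/-- The dispersion is finite. [folklore] -/
@[simp]
theorem fracDispersion_ne_top (α L : ℝ) (p : Fin 3 → ℤ) : fracDispersion α L p ≠ ⊤ :=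
  ENNReal.ofReal_ne_top

/-- `|k|² = 4π²|p|²/L²` at `α = 2`: the weight of `tsum_sq_grad_cellFourierCoeff`. [folklore] -/
theorem fracDispersion_two (L : ℝ) (p : Fin 3 → ℤ) :
    fracDispersion 2 L p = ENNReal.ofReal (4 * Real.pi ^ 2 * (∑ k, (p k : ℝ) ^ 2) / L ^ 2) := by
  unfold fracDispersion
  congr 1
  rw [Real.rpow_two, mul_pow, Real.sq_sqrt (Finset.sum_nonneg fun k _ => sq_nonneg _)]
  ring

/-- The zero mode has no kinetic energy: `|k|^α = 0` at `p = 0` for `α ≠ 0`. [folklore] -/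
theorem fracDispersion_zero {α : ℝ} (hα : α ≠ 0) (L : ℝ) : fracDispersion α L 0 = 0 := by
  simp [fracDispersion, Real.zero_rpow hα]

/-- `|k|^α ≤ 1 + |k|²` for `0 < α ≤ 2` (split at `|k| = 1`). [folklore] -/
theorem fracDispersion_le_one_add {α : ℝ} (hα : 0 < α) (hα2 : α ≤ 2) (L : ℝ) (p : Fin 3 → ℤ) :
    fracDispersion α L p ≤ 1 + fracDispersion 2 L p := by
  unfold fracDispersion
  set t : ℝ := 2 * Real.pi / L * Real.sqrt (∑ k : Fin 3, ((p k : ℤ) : ℝ) ^ 2) with ht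
  have habs : ENNReal.ofReal (t ^ α) ≤ ENNReal.ofReal (|t| ^ α) :=
    ENNReal.ofReal_le_ofReal ((le_abs_self _).trans (Real.abs_rpow_le_abs_rpow t α))
  have htwo : t ^ (2 : ℝ) = |t| ^ (2 : ℝ) := by rw [Real.rpow_two, Real.rpow_two, sq_abs]
  rw [htwo]
  refine habs.trans ?_
  have h0 : 0 ≤ |t| := abs_nonneg t
  rcases le_total |t| 1 with h1 | h1
  · calc ENNReal.ofReal (|t| ^ α) ≤ 1 := by
          rw [ENNReal.ofReal_le_one]; exact Real.rpow_le_one h0 h1 hα.le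
      _ ≤ 1 + ENNReal.ofReal (|t| ^ (2 : ℝ)) := le_self_add
  · calc ENNReal.ofReal (|t| ^ α) ≤ ENNReal.ofReal (|t| ^ (2 : ℝ)) :=
          ENNReal.ofReal_le_ofReal (Real.rpow_le_rpow_of_exponent_le h1 hα2)
      _ ≤ 1 + ENNReal.ofReal (|t| ^ (2 : ℝ)) := le_add_self

/-! ### Slices at the first particle (Fubini bookkeeping) -/

/-- The partial gradient in particle `i`: `|∇ᵢΨ(X)|² = ∑ₖ |∂Ψ/∂x_{i,k}(X)|²` (local notation for
the `i`-th summand of `kineticDensity`, as in `PeriodicBoseGasThm31`). -/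
local notation "gradSqAt[" i ", " Ψ ", " X "]" =>
  ∑ k : Fin 3, (‖fderiv ℝ Ψ X (Pi.single i (EuclideanSpace.single k (1 : ℝ)))‖₊ : ℝ≥0∞) ^ 2

section Slices

variable {n : ℕ} {L : ℝ}

/-- **Tonelli, first particle split off**: `∫_{Ω^{n+1}} F = ∫_{Ω^n} ∫_Ω F(x, Y) dx dY`
(`Ω^{n+1} ≅ Ω × Ω^n` is measure preserving, `measurePreserving_piFinSuccAbove`). [folklore] -/
theorem lintegral_cellN_succ (L : ℝ) {F : Config (n + 1) → ℝ≥0∞} (hF : Measurable F) :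
    ∫⁻ X in cellN (n + 1) L, F X = ∫⁻ Y in cellN n L, ∫⁻ x in cell L, F (Matrix.vecCons x Y) := by
  set μ : Fin (n + 1) → Measure Space := fun _ => volume.restrict (cell L) with hμ
  have hmp := measurePreserving_piFinSuccAbove μ 0
  have hG : ∀ (x : Space) (Y : Config n),
      (MeasurableEquiv.piFinSuccAbove (fun _ : Fin (n + 1) => Space) 0).symm (x, Y) =
        Matrix.vecCons x Y := by
    intro x Y
    change Fin.insertNth 0 x Y = (Fin.cons x Y : Config (n + 1))
    exact Fin.insertNth_zero' x Y
  rw [volume_restrict_cellN, volume_restrict_cellN, hmp.symm.lintegral_map_equiv F,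
    lintegral_prod_symm
      (fun z => F ((MeasurableEquiv.piFinSuccAbove (fun _ : Fin (n + 1) => Space) 0).symm z))
      (hF.comp (MeasurableEquiv.measurable _)).aemeasurable]
  simp only [hG]
  rfl

/-- **Occupations through slices**: for a one-body mode `φ` and an `(n+1)`-body function `Ψ`,
`⟨φ, γ_Ψ φ⟩_cell = (n+1) ∫_{Ω^n} |∫_Ω conj(φ(x)) Ψ(x, Y) dx|² dY` (unfolding `occupation` and the
cell indicators). [cite: LSSY2005, §1.2 (1.17)] -/
theorem cellOccupation_succ (L : ℝ) (φ : Space → ℂ) (Ψ : Config (n + 1) → ℂ) :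
    cellOccupation (n + 1) L φ Ψ = (n + 1 : ℝ≥0∞) *
      ∫⁻ Y in cellN n L, (‖∫ x in cell L, conj (φ x) * Ψ (Matrix.vecCons x Y)‖₊ : ℝ≥0∞) ^ 2 := by
  unfold cellOccupation occupation
  have hpt : ∀ Y : Config n,
      (‖∫ x, conj ((cell L).indicator φ x) *
          (cellN (n + 1) L).indicator Ψ (Matrix.vecCons x Y)‖₊ : ℝ≥0∞) ^ 2 =
        (cellN n L).indicator
          (fun Y => (‖∫ x in cell L, conj (φ x) * Ψ (Matrix.vecCons x Y)‖₊ : ℝ≥0∞) ^ 2) Y := by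
    intro Y
    by_cases hY : Y ∈ cellN n L
    · rw [Set.indicator_of_mem hY]
      have hint : (fun x => conj ((cell L).indicator φ x) *
          (cellN (n + 1) L).indicator Ψ (Matrix.vecCons x Y)) =
          (cell L).indicator (fun x => conj (φ x) * Ψ (Matrix.vecCons x Y)) := by
        funext x
        by_cases hx : x ∈ cell L
        · have hmem : Matrix.vecCons x Y ∈ cellN (n + 1) L := by
            intro j
            refine Fin.cases ?_ (fun k => ?_) j
            · simpa using hx
            · simpa using hY k
          simp [hx, hmem, Set.indicator_of_mem]
        · simp [hx]
      rw [hint, integral_indicator (measurableSet_cell L)]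
    · rw [Set.indicator_of_notMem hY]
      have hint : (fun x => conj ((cell L).indicator φ x) *
          (cellN (n + 1) L).indicator Ψ (Matrix.vecCons x Y)) = fun _ => 0 := by
        funext x
        have hmem : Matrix.vecCons x Y ∉ cellN (n + 1) L := by
          intro h
          exact hY fun k => by simpa using h k.succ
        simp [hmem]
      rw [hint]
      simp
  simp only [hpt]
  rw [lintegral_indicator (measurableSet_cellN n L)]

/-- Measurability in the spectator variables of the slice inner products
`Y ↦ |∫_Ω conj(φ) Ψ(·, Y)|²` (continuous `φ`, `Ψ`). [folklore] -/
theorem measurable_sliceInner {φ : Space → ℂ} (hφ : Continuous φ) {Ψ : Config (n + 1) → ℂ}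
    (hΨ : Continuous Ψ) :
    Measurable fun Y : Config n =>
      (‖∫ x in cell L, conj (φ x) * Ψ (Matrix.vecCons x Y)‖₊ : ℝ≥0∞) ^ 2 := by
  have h : StronglyMeasurable
      (Function.uncurry fun (Y : Config n) (x : Space) => conj (φ x) * Ψ (Matrix.vecCons x Y)) := by
    refine Continuous.stronglyMeasurable ?_
    exact (Complex.continuous_conj.comp (hφ.comp continuous_snd)).mul
      (hΨ.comp (continuous_snd.matrixVecCons continuous_fst))
  exact ((h.integral_prod_right'
    (ν := volume.restrict (cell L))).measurable.nnnorm.coe_nnreal_ennreal).pow_const _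

/-- Chain rule for slices at the first particle: the gradient of `x ↦ Ψ(x, Y)` is `∇₀Ψ(x, Y)`.
[folklore] -/
theorem gradSqC_vecCons {Ψ : Config (n + 1) → ℂ} (hΨ : Differentiable ℝ Ψ) (x : Space)
    (Y : Config n) :
    gradSqC (fun y => Ψ (Matrix.vecCons y Y)) x = gradSqAt[0, Ψ, Matrix.vecCons x Y] := by
  have h := gradSqC_slice hΨ (Matrix.vecCons x Y) 0 x
  have hupd : ∀ y, Function.update (Matrix.vecCons x Y) 0 y = Matrix.vecCons y Y := fun y =>
    Fin.update_cons_zero (α := fun _ => Space) x Y y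
  simp only [hupd] at h
  exact h

/-- `eᵢ ⊗ v` relabelled by the transposition `(0 i)` is `e₀ ⊗ v`. [folklore] -/
theorem single_comp_swap {M : Type*} [Zero M] (i : Fin (n + 1)) (v : M) :
    (Pi.single i v : Fin (n + 1) → M) ∘ Equiv.swap 0 i = Pi.single 0 v := by
  funext j
  simp only [Function.comp_apply]
  by_cases hj0 : j = 0
  · subst hj0
    simp
  · by_cases hji : j = i
    · subst hji
      rw [Equiv.swap_apply_right, Pi.single_eq_of_ne (Ne.symm hj0), Pi.single_eq_of_ne hj0]
    · rw [Equiv.swap_apply_of_ne_of_ne hj0 hji, Pi.single_eq_of_ne hji, Pi.single_eq_of_ne hj0]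

/-- **Bose symmetry moves the partial gradient to the first slot**:
`|∇ᵢΨ(X)|² = |∇₀Ψ(X ∘ (0 i))|²` for a permutation-symmetric differentiable `Ψ` (chain rule for the
linear relabelling `X ↦ X ∘ (0 i)`). [folklore] -/
theorem gradSqAt_eq_zero_comp_swap {Ψ : Config (n + 1) → ℂ} (hΨ : Differentiable ℝ Ψ)
    (hsymm : ∀ (σ : Equiv.Perm (Fin (n + 1))) (X : Config (n + 1)), Ψ (X ∘ σ) = Ψ X)
    (i : Fin (n + 1)) (X : Config (n + 1)) :
    gradSqAt[i, Ψ, X] = gradSqAt[0, Ψ, X ∘ Equiv.swap 0 i] := by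
  set σ : Equiv.Perm (Fin (n + 1)) := Equiv.swap 0 i with hσ
  -- the relabelling `X ↦ X ∘ σ` as a continuous linear map
  set P : Config (n + 1) →L[ℝ] Config (n + 1) :=
    ContinuousLinearMap.pi fun j =>
      (ContinuousLinearMap.proj (σ j) : Config (n + 1) →L[ℝ] Space) with hP
  have hPX : ∀ Z : Config (n + 1), P Z = Z ∘ σ := fun Z => rfl
  have hcomp : Ψ ∘ P = Ψ := funext fun Z => by rw [Function.comp_apply, hPX, hsymm]
  have h2 : fderiv ℝ Ψ X = (fderiv ℝ Ψ (P X)).comp P := by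
    have := fderiv_comp X (hΨ (P X)) P.differentiableAt
    rwa [hcomp, P.fderiv] at this
  refine Finset.sum_congr rfl fun k _ => ?_
  rw [h2, ContinuousLinearMap.comp_apply, hPX, hPX, single_comp_swap]

end Slices

/-! ### Occupations of the plane waves -/

/-- **The zero mode is the condensate**: `⟨φ_0, γ_Ψ φ_0⟩ = ⟨Ψ, n₀ Ψ⟩ = condensateOccupation N L Ψ`.
[cite: Fournais2020, (1.3)–(1.5)] -/
theorem cellOccupation_planeWaveMode_zero (N : ℕ) (L : ℝ) (Ψ : Config N → ℂ) :
    cellOccupation N L (planeWaveMode L 0) Ψ = condensateOccupation N L Ψ := by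
  rw [cellOccupation, indicator_planeWaveMode_zero]
  rfl

/-- **Parseval in the traced variable** (`tr γ_Ψ = N‖Ψ‖²`): for a continuous `N`-body function
`Ψ` (no periodicity or symmetry needed), `∑_{p ∈ ℤ³} ⟨φ_p, γ_Ψ φ_p⟩ = N ∫_{Ω^N} |Ψ|²` — Parseval on
the cell for each slice `x ↦ Ψ(x, Y)`, then Tonelli. [cite: LSSY2005, §1.2 (1.17)–(1.18)] -/
theorem tsum_cellOccupation_planeWaveMode_eq {N : ℕ} {L : ℝ} (hL : 0 < L) {Ψ : Config N → ℂ}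
    (hΨ : Continuous Ψ) :
    ∑' p : Fin 3 → ℤ, cellOccupation N L (planeWaveMode L p) Ψ =
      (N : ℝ≥0∞) * ∫⁻ X in cellN N L, (‖Ψ X‖₊ : ℝ≥0∞) ^ 2 := by
  cases N with
  | zero => simp [cellOccupation, occupation]
  | succ n =>
    have hL3 : ENNReal.ofReal L ^ 3 ≠ 0 := pow_ne_zero _ (by simpa using hL)
    have hL3' : ENNReal.ofReal L ^ 3 ≠ ⊤ := ENNReal.pow_ne_top ENNReal.ofReal_ne_top
    have hslice : ∀ Y : Config n, Continuous fun x => Ψ (Matrix.vecCons x Y) := fun Y =>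
      hΨ.comp (continuous_id.matrixVecCons continuous_const)
    simp only [cellOccupation_succ]
    rw [ENNReal.tsum_mul_left, ← lintegral_tsum fun p =>
      (measurable_sliceInner (continuous_planeWaveMode L p) hΨ).aemeasurable,
      lintegral_cellN_succ L (hΨ.measurable.nnnorm.coe_nnreal_ennreal.pow_const _)]
    push_cast
    congr 1
    refine lintegral_congr fun Y => ?_
    simp only [nnnorm_sq_integral_conj_planeWaveMode_mul hL]
    rw [ENNReal.tsum_mul_left, tsum_sq_cellFourierCoeff hL (hslice Y), ← mul_assoc,
      ENNReal.mul_inv_cancel hL3 hL3', one_mul]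

/-- For a periodic trial state the plane-wave occupations sum to the particle number:
`∑_{p ∈ ℤ³} ⟨φ_p, γ_Ψ φ_p⟩ = N` (`tr γ_Ψ = N`). [cite: LSSY2005, §1.2 (1.18)] -/
theorem PeriodicTrialState.tsum_cellOccupation_planeWaveMode {N : ℕ} {L : ℝ} (hL : 0 < L)
    (Ψ : PeriodicTrialState N L) :
    ∑' p : Fin 3 → ℤ, cellOccupation N L (planeWaveMode L p) Ψ.ψ = N := by
  rw [tsum_cellOccupation_planeWaveMode_eq hL Ψ.contDiff.continuous, Ψ.norm_eq, mul_one]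

/-- Each plane-wave occupation of a periodic trial state is at most `N`; in particular
`condensateOccupation N L Ψ.ψ ≤ N` (`p = 0`). [cite: LSSY2005, §1.2 (1.18)] -/
theorem PeriodicTrialState.cellOccupation_planeWaveMode_le {N : ℕ} {L : ℝ} (hL : 0 < L)
    (Ψ : PeriodicTrialState N L) (p : Fin 3 → ℤ) :
    cellOccupation N L (planeWaveMode L p) Ψ.ψ ≤ N := by
  rw [← Ψ.tsum_cellOccupation_planeWaveMode hL]
  exact ENNReal.le_tsum p

/-- **Parseval for the gradient in the traced variable**: for a periodic trial state,
`∑_{p ∈ ℤ³} |2πp/L|² ⟨φ_p, γ_Ψ φ_p⟩ = ∫_{Ω^N} |∇Ψ|² = ⟨Ψ, ∑ᵢ(-Δᵢ)Ψ⟩` — the derivative rule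
`ĉ_p(∂ⱼf) = (2πi pⱼ/L) ĉ_p(f)` on the 3-torus for each slice `x ↦ Ψ(x, Y)` (periodic, `C¹`),
Tonelli over `Y`, and Bose symmetry (`N ∫|∇₀Ψ|² = ∑ᵢ ∫|∇ᵢΨ|²`). [cite: LSSY2005, §1.2 (1.16)–(1.17)] -/
theorem tsum_fracDispersion_two_mul_cellOccupation {N : ℕ} {L : ℝ} (hL : 0 < L)
    (Ψ : PeriodicTrialState N L) :
    ∑' p : Fin 3 → ℤ, fracDispersion 2 L p * cellOccupation N L (planeWaveMode L p) Ψ.ψ =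
      ∫⁻ X in cellN N L, kineticDensity Ψ.ψ X := by
  cases N with
  | zero => simp [cellOccupation, occupation, kineticDensity]
  | succ n =>
    have hL3 : ENNReal.ofReal L ^ 3 ≠ 0 := pow_ne_zero _ (by simpa using hL)
    have hL3' : ENNReal.ofReal L ^ 3 ≠ ⊤ := ENNReal.pow_ne_top ENNReal.ofReal_ne_top
    have hcont : Continuous Ψ.ψ := Ψ.contDiff.continuous
    have hdiff : Differentiable ℝ Ψ.ψ := Ψ.contDiff.differentiable one_ne_zero
    -- the slices at the first particle are `C¹` and periodic
    have hupd : ∀ (Y : Config n) (x : Space),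
        Function.update (Matrix.vecCons (0 : Space) Y) 0 x = Matrix.vecCons x Y := fun Y x =>
      Fin.update_cons_zero (α := fun _ => Space) 0 Y x
    have hC1 : ∀ Y : Config n, ContDiff ℝ 1 fun x => Ψ.ψ (Matrix.vecCons x Y) := fun Y => by
      simpa only [hupd] using Ψ.contDiff_slice (Matrix.vecCons 0 Y) 0
    have hper : ∀ (Y : Config n) (x : Space) (k : Fin 3),
        Ψ.ψ (Matrix.vecCons (x + EuclideanSpace.single k L) Y) = Ψ.ψ (Matrix.vecCons x Y) :=
      fun Y x k => by simpa only [hupd] using Ψ.periodic_slice (Matrix.vecCons 0 Y) 0 x k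
    -- Step 1: each summand through the slices
    have hS : ∀ p, fracDispersion 2 L p * cellOccupation (n + 1) L (planeWaveMode L p) Ψ.ψ =
        (n + 1 : ℝ≥0∞) * ∫⁻ Y in cellN n L, fracDispersion 2 L p *
          (‖∫ x in cell L, conj (planeWaveMode L p x) * Ψ.ψ (Matrix.vecCons x Y)‖₊ : ℝ≥0∞) ^ 2 := by
      intro p
      rw [cellOccupation_succ, lintegral_const_mul' _ _ (fracDispersion_ne_top 2 L p), mul_left_comm]
    simp only [hS]
    rw [ENNReal.tsum_mul_left, ← lintegral_tsum fun p =>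
      ((measurable_sliceInner (continuous_planeWaveMode L p) hcont).const_mul _).aemeasurable]
    -- Step 2: Parseval for the gradient of each slice, and the chain rule
    have hinner : ∀ Y : Config n, ∑' p, fracDispersion 2 L p *
        (‖∫ x in cell L, conj (planeWaveMode L p x) * Ψ.ψ (Matrix.vecCons x Y)‖₊ : ℝ≥0∞) ^ 2 =
        ∫⁻ x in cell L, gradSqAt[0, Ψ.ψ, Matrix.vecCons x Y] := by
      intro Y
      simp only [nnnorm_sq_integral_conj_planeWaveMode_mul hL, fracDispersion_two,
        mul_left_comm _ (ENNReal.ofReal L ^ 3)]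
      rw [ENNReal.tsum_mul_left, tsum_sq_grad_cellFourierCoeff hL (hC1 Y) (hper Y), ← mul_assoc,
        ENNReal.mul_inv_cancel hL3 hL3', one_mul]
      refine lintegral_congr fun x => ?_
      exact gradSqC_vecCons hdiff x Y
    simp only [hinner]
    -- Step 3: undo the slicing and use Bose symmetry
    rw [← lintegral_cellN_succ L (measurable_gradSqAt 0 Ψ.ψ)]
    simp only [kineticDensity_eq_sum_gradSqAt]
    rw [lintegral_finsetSum _ fun i _ => measurable_gradSqAt i Ψ.ψ]
    have hi : ∀ i : Fin (n + 1), ∫⁻ X in cellN (n + 1) L, gradSqAt[i, Ψ.ψ, X] =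
        ∫⁻ X in cellN (n + 1) L, gradSqAt[0, Ψ.ψ, X] := fun i => by
      have h1 : (fun X => gradSqAt[i, Ψ.ψ, X]) = fun X => gradSqAt[0, Ψ.ψ, X ∘ Equiv.swap 0 i] :=
        funext fun X => gradSqAt_eq_zero_comp_swap hdiff Ψ.symm i X
      rw [h1, lintegral_cellN_comp_perm (Equiv.swap 0 i) (fun X => gradSqAt[0, Ψ.ψ, X])]
    simp only [hi, Finset.sum_const, Finset.card_univ, Fintype.card_fin, nsmul_eq_mul, Nat.cast_add,
      Nat.cast_one]

/-! ### The endpoint `α = 2` and the comparison `|k|^α ≤ 1 + |k|²` -/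

/-- **`α = 2` is the periodic energy** (route BECDispersionDial, support item FracEnergyAtTwo):
`fracPeriodicEnergy 2 v N L Ψ.ψ = periodicEnergy v Ψ` for every periodic trial state on a torus of
side `L > 0`. [cite: Fournais2020, (1.1)] -/
theorem fracPeriodicEnergy_two {N : ℕ} {L : ℝ} (hL : 0 < L) (v : ℝ → ℝ≥0∞)
    (Ψ : PeriodicTrialState N L) : fracPeriodicEnergy 2 v N L Ψ.ψ = periodicEnergy v Ψ := by
  -- `kineticDensity` is measurable for any `Ψ` (as `kineticDensity_measurable` of
  -- `PeriodicBoseGasJastrow.lean`, not imported here)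
  have hmeas : Measurable (kineticDensity Ψ.ψ) :=
    Finset.measurable_sum _ fun i _ => measurable_gradSqAt i Ψ.ψ
  rw [fracPeriodicEnergy_apply, tsum_fracDispersion_two_mul_cellOccupation hL Ψ, periodicEnergy,
    ← lintegral_add_left hmeas]

/-- `E_2(N, L) = periodicGroundStateEnergy v N L`. [cite: Fournais2020, (1.2)] -/
theorem fracPeriodicGroundStateEnergy_two {L : ℝ} (hL : 0 < L) (v : ℝ → ℝ≥0∞) (N : ℕ) :
    fracPeriodicGroundStateEnergy 2 v N L = periodicGroundStateEnergy v N L :=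
  iInf_congr fun Ψ => fracPeriodicEnergy_two hL v Ψ

/-- **Monotone comparison of the dial with its endpoint**: `𝓔_α(Ψ) ≤ N + 𝓔_2(Ψ)` for
`0 < α ≤ 2` and periodic trial states (`|k|^α ≤ 1 + |k|²` termwise and `∑_p ⟨φ_p, γ_Ψ φ_p⟩ = N`).
[folklore] -/
theorem fracPeriodicEnergy_le_add_two {α : ℝ} (hα : 0 < α) (hα2 : α ≤ 2) {N : ℕ} {L : ℝ}
    (hL : 0 < L) (v : ℝ → ℝ≥0∞) (Ψ : PeriodicTrialState N L) :
    fracPeriodicEnergy α v N L Ψ.ψ ≤ N + fracPeriodicEnergy 2 v N L Ψ.ψ := by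
  rw [fracPeriodicEnergy_apply, fracPeriodicEnergy_apply, ← add_assoc]
  gcongr ?_ + _
  calc ∑' p, fracDispersion α L p * cellOccupation N L (planeWaveMode L p) Ψ.ψ
      ≤ ∑' p, (1 + fracDispersion 2 L p) * cellOccupation N L (planeWaveMode L p) Ψ.ψ :=
        ENNReal.tsum_le_tsum fun p => by gcongr; exact fracDispersion_le_one_add hα hα2 L p
    _ = (∑' p, cellOccupation N L (planeWaveMode L p) Ψ.ψ) +
          ∑' p, fracDispersion 2 L p * cellOccupation N L (planeWaveMode L p) Ψ.ψ := by
        simp only [add_mul, one_mul]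
        exact ENNReal.tsum_add
    _ = N + ∑' p, fracDispersion 2 L p * cellOccupation N L (planeWaveMode L p) Ψ.ψ := by
        rw [Ψ.tsum_cellOccupation_planeWaveMode hL]

/-- In particular `𝓔_α(Ψ) ≤ N + ⟨Ψ, HΨ⟩` with the ordinary periodic energy. [folklore] -/
theorem fracPeriodicEnergy_le_add_periodicEnergy {α : ℝ} (hα : 0 < α) (hα2 : α ≤ 2) {N : ℕ}
    {L : ℝ} (hL : 0 < L) (v : ℝ → ℝ≥0∞) (Ψ : PeriodicTrialState N L) :
    fracPeriodicEnergy α v N L Ψ.ψ ≤ N + periodicEnergy v Ψ := by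
  rw [← fracPeriodicEnergy_two hL v Ψ]
  exact fracPeriodicEnergy_le_add_two hα hα2 hL v Ψ

/-- And for the ground-state energies: `E_α(N, L) ≤ N + E^per(N, L)` for `0 < α ≤ 2`. [folklore] -/
theorem fracPeriodicGroundStateEnergy_le_add {α : ℝ} (hα : 0 < α) (hα2 : α ≤ 2) {N : ℕ} {L : ℝ}
    (hL : 0 < L) (v : ℝ → ℝ≥0∞) :
    fracPeriodicGroundStateEnergy α v N L ≤ N + periodicGroundStateEnergy v N L := by
  rw [periodicGroundStateEnergy, ENNReal.add_iInf]
  exact le_iInf fun Ψ => (fracPeriodicGroundStateEnergy_le α v Ψ).trans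
    (fracPeriodicEnergy_le_add_periodicEnergy hα hα2 hL v Ψ)

/-! ### Continuity of the dial at the endpoint -/

/-- **Continuity of the dial at its endpoint.** For a periodic trial state of finite energy on a
torus of side `L > 0`, `𝓔_α(Ψ) → ⟨Ψ, HΨ⟩` as `α ↑ 2`: dominated convergence on `ℓ¹(ℤ³)` (counting
measure) with the summable bound `|k|^α n_p ≤ (1 + |k|²) n_p` for `0 < α ≤ 2`
(`∑_p (1 + |k|²) n_p = N + ∫_{Ω^N}|∇Ψ|² ≤ N + ⟨Ψ, HΨ⟩ < ∞`) and the continuity of `α ↦ |k|^α` —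
the first step ("`E_α → periodicEnergy` on `C¹` periodic states") of the mechanism of the route's
crux EndpointTransfer. [folklore] -/
theorem tendsto_fracPeriodicEnergy {N : ℕ} {L : ℝ} (hL : 0 < L) (v : ℝ → ℝ≥0∞)
    (Ψ : PeriodicTrialState N L) (hfin : periodicEnergy v Ψ ≠ ⊤) :
    Tendsto (fun α => fracPeriodicEnergy α v N L Ψ.ψ) (𝓝[<] 2) (𝓝 (periodicEnergy v Ψ)) := by
  rw [← fracPeriodicEnergy_two hL v Ψ]
  simp only [fracPeriodicEnergy_apply]
  refine Tendsto.add ?_ tendsto_const_nhds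
  have hn_top : ∀ p, cellOccupation N L (planeWaveMode L p) Ψ.ψ ≠ ⊤ := fun p =>
    ne_top_of_le_ne_top (ENNReal.natCast_ne_top N) (Ψ.cellOccupation_planeWaveMode_le hL p)
  -- the sums as integrals against the counting measure on `ℤ³`
  have hcount : ∀ g : (Fin 3 → ℤ) → ℝ≥0∞, ∑' p, g p = ∫⁻ p, g p ∂Measure.count := fun g =>
    (lintegral_count g).symm
  simp only [hcount]
  refine tendsto_lintegral_filter_of_dominated_convergence
    (fun p => (1 + fracDispersion 2 L p) * cellOccupation N L (planeWaveMode L p) Ψ.ψ)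
    (Eventually.of_forall fun α => measurable_of_countable _) ?_ ?_ ?_
  · -- domination for `α ∈ (0, 2)`
    filter_upwards [Ioo_mem_nhdsLT (show (0 : ℝ) < 2 by norm_num)] with α hα
    refine Eventually.of_forall fun p => ?_
    gcongr
    exact fracDispersion_le_one_add hα.1 hα.2.le L p
  · -- the bound is summable: `∑_p (1 + |k|²) n_p = N + ∫|∇Ψ|² ≤ N + ⟨Ψ, HΨ⟩ < ∞`
    rw [lintegral_count]
    simp only [add_mul, one_mul]
    rw [ENNReal.tsum_add, Ψ.tsum_cellOccupation_planeWaveMode hL,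
      tsum_fracDispersion_two_mul_cellOccupation hL Ψ]
    refine ENNReal.add_ne_top.2 ⟨ENNReal.natCast_ne_top N, ne_top_of_le_ne_top hfin ?_⟩
    exact lintegral_mono fun X => le_self_add
  · -- termwise convergence: `α ↦ |k|^α` is continuous at `α = 2`
    refine Eventually.of_forall fun p => ?_
    refine ENNReal.Tendsto.mul_const ?_ (Or.inr (hn_top p))
    have ht : Tendsto
        (fun α : ℝ => (2 * Real.pi / L * Real.sqrt (∑ k : Fin 3, ((p k : ℤ) : ℝ) ^ 2)) ^ α) (𝓝 2)
        (𝓝 ((2 * Real.pi / L * Real.sqrt (∑ k : Fin 3, ((p k : ℤ) : ℝ) ^ 2)) ^ (2 : ℝ))) :=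
      (Real.continuousAt_const_rpow' two_ne_zero).tendsto
    exact ((ENNReal.continuous_ofReal.tendsto _).comp ht).mono_left nhdsWithin_le_nhds

/-- The same for the ground-state energies from above: `limsup_{α ↑ 2} E_α(N, L) ≤ E^per(N, L)`
(test every periodic trial state of finite energy). [folklore] -/
theorem limsup_fracPeriodicGroundStateEnergy_le {N : ℕ} {L : ℝ} (hL : 0 < L) (v : ℝ → ℝ≥0∞) :
    limsup (fun α => fracPeriodicGroundStateEnergy α v N L) (𝓝[<] 2) ≤
      periodicGroundStateEnergy v N L := by
  refine le_iInf fun Ψ => ?_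
  by_cases hfin : periodicEnergy v Ψ = ⊤
  · rw [hfin]; exact le_top
  refine le_of_le_of_eq (limsup_le_limsup (Eventually.of_forall fun α =>
    fracPeriodicGroundStateEnergy_le α v Ψ)) (tendsto_fracPeriodicEnergy hL v Ψ hfin).limsup_eq

end Literature.MathematicalPhysics.QuantumManyBody.BoseGas

end
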